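import Summits.MatrixMultiplication.OmegaCensus.LocalUSPOmegaBound
import Summits.MatrixMultiplication.OmegaCensus.LocalUSPChartBound

/-!
# ω-census, family (b1): kernel row for a 14-row local strong USP of width 9 (eng1 usp v4 object, 2026-08-20)

HONEST FRAMING (pub-omega census; verbatim): lottery ticket; floor = certified bounds/negative ranges.
Census bookkeeping, not progress on `ω` (tree: `ω < 2.373`).  Sibling of `LocalUSPInstancesK789.lean` / `LocalUSPInstancesK9*.lean`
(group seat: largest puzzles found by the SAT census) and `LocalUSPInstanceW8U17.lean` (ENG1).  The ENG1 seat's exact search (eng1 `usp4`: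
composition-ordered forced roots, root-stabiliser pruning, clique search) met the 14-row local strong USP of width 9 below (symbols `1,2,3`
coded `0,1,2`), re-verified from the definition by two independent checkers before this file was cut.  Proof shape as in the sibling files:
`decide` (pattern property of the explicit puzzle) + `decide +kernel` (one integer inequality) + `omega_le_div_of_isLocalStrongUSP` (CKSU 2005, tree-proved).
Maximality of 14 at width 9 is NOT claimed here.
-/

noncomputable section

open Literature.Computability.AlgebraicComplexity

namespace Summit.MatrixMultiplication.OmegaCensus

/-- Census row (b1-S) `w9_s14`: the local strong USP `{112221333 333112122 332211123 133212123 332111322 313121322 313122132 312211332 313221123 132122133 132121323 132112332 113222133 113212332}` (14 rows, width 9;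
found by the ENG1 exact search eng1 `usp4` on 2026-08-20; maximality at width 9 not claimed) with modulus `m = 12` certifies
`ω ≤ 2.7421 = 27421/10000` (integer certificate `12^270000 ≤ 14^30000·11^246789`, tight in the last digit: the exponent `27420·9` fails;
exact value of the row `3(9 log 12 − log 14)/(9 log 11)`). [cite: CohnKleinbergSzegedyUmans2005, Thm. 33 and Thm. 31] -/
theorem omega_le_of_localSUSP_w9_s14 : omega ℂ ≤ 2.7421 := by
  have h := omega_le_div_of_isLocalStrongUSP (row := ![![0, 0, 1, 1, 1, 0, 2, 2, 2], ![2, 2, 2, 0, 0, 1, 0, 1, 1], ![2, 2, 1, 1, 0, 0, 0, 1, 2], ![0, 2, 2, 1, 0, 1, 0, 1, 2], ![2, 2, 1, 0, 0, 0, 2, 1, 1], ![2, 0, 2, 0, 1, 0, 2, 1, 1], ![2, 0, 2, 0, 1, 1, 0, 2, 1], ![2, 0, 1, 1, 0, 0, 2, 2, 1], ![2, 0, 2, 1, 1, 0, 0, 1, 2], ![0, 2, 1, 0, 1, 1, 0, 2, 2], ![0, 2, 1, 0, 1, 0, 2, 1, 2], ![0, 2, 1, 0, 0, 1, 2, 2,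 1], ![0, 0, 2, 1, 1, 1, 0, 2, 2], ![0, 0, 2, 1, 0, 1, 2, 2, 1]])
    (by unfold IsLocalStrongUSP localStrongUSPPatterns; decide +kernel) (by norm_num) (by norm_num)
    (m := 12) (by norm_num) (a := 27421) (b := 10000) (by norm_num) (by decide +kernel)
  have e : ((27421 : ℕ) : ℝ) / ((10000 : ℕ) : ℝ) = 2.7421 := by norm_num
  rwa [e] at h

end Summit.MatrixMultiplication.OmegaCensus

end
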